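import Summits.Ventures.PercRepro.S3LPCellKit

/-!
# PercRepro — THE MAXIMAL-FLAT KIT (p7 g22, S3 feeder): the rows of a level-`q` cell when a rank-`q` set has the
coloop-free maximum `n − (p − q + 1)` of points

The LP adversary of the open level-`6` cells `(9, 9)`, `(9, 10)`, `(9, 11)` lives on the maximal rank-`6` flats (`n − 4` points).
Let `M` be coloop-free of rank `p` and `F ⊆ E` of rank `q < p` with `|E ∖ F| = p − q + 1 =: c`, `X := E ∖ F`. Then (the points of
`X` are not coloops) `ρ(F ∪ T) = q + |T|` for every `T ⊊ X`, hence `ρ(S ∪ T) = ρ(S) + |T|` for `S ⊆ F`, `T ⊊ X` (submodularity).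
Consequences, with `fSets F k r := rkSets (M ↾ F) k r` = the `k`-subsets of `F` of rank `r` (no new definition):
* a `U`-set meets `X` in at most one point: `#uSets k ≤ #fSets F k q + c · #fSets F (k−1) (q−1)`;
* the sets `S ∪ T` (`S ∈ fSets F (k−j) (r−j)`, `T ⊆ X`, `|T| = j < c`) are `C(c, j)·#fSets F (k−j) (r−j)` distinct `k`-sets of rank `r`,
  disjoint for distinct `j`: the rows `Σ_j C(c,j)·#fSets F (k−j) (r−j) ≤ m[k, r]`;
* the partition rows of `F`: `Σ_{2 ≤ r ≤ q} #fSets F k r = C(|F|, k)` (`k ≥ 2`) and the zero classes `fSets F k r ⊆ rkSets M k r`.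
Also the unsplit closure instance with an arbitrary flat-size hypothesis (`cl_inst_flatH`), for the complementary case.
The counting rows (the glued sets, the `U`-row, the `Y`-rows) are in S3MaxFlatGlue.
Axioms: standard.
-/

open scoped Matroid

namespace PercRepro

namespace S3MF

open Set Finset S2LP S3LP

variable {α : Type} {M : Matroid α} [M.Finite]

omit [M.Finite] in
/-- **The `k`-subsets of `F` of rank `r`** are the rank classes of the restriction `M ↾ F`. -/
theorem mem_rkSets_restrict {F S : Set α} {k r : ℕ} :
    S ∈ S1.rkSets (M ↾ F) k r ↔ S ⊆ F ∧ S.ncard = k ∧ M.eRk S = (r : ℕ∞) := by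
  unfold S1.rkSets
  simp only [Set.mem_setOf_eq, Matroid.restrict_ground_eq]
  constructor
  · rintro ⟨h1, h2, h3⟩
    exact ⟨h1, h2, by rwa [M.restrict_eRk_eq h1] at h3⟩
  · rintro ⟨h1, h2, h3⟩
    exact ⟨h1, h2, by rwa [M.restrict_eRk_eq h1]⟩

omit [M.Finite] in
/-- `rkSets (M ↾ F) k r ⊆ rkSets M k r` for `F ⊆ E`. -/
theorem fSets_subset_rkSets {F : Set α} (hF : F ⊆ M.E) (k r : ℕ) : S1.rkSets (M ↾ F) k r ⊆ S1.rkSets M k r := by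
  intro S hS
  obtain ⟨h1, h2, h3⟩ := mem_rkSets_restrict.1 hS
  exact ⟨h1.trans hF, h2, h3⟩

/-- The rank classes of `M ↾ F` are finite. -/
theorem fSets_finite {F : Set α} (hF : F ⊆ M.E) (k r : ℕ) : (S1.rkSets (M ↾ F) k r).Finite :=
  (S1.rkSets_finite k r).subset (fSets_subset_rkSets hF k r)

/-- `#rkSets (M ↾ F) k r ≤ m[k, r]`. -/
theorem ncard_fSets_le {F : Set α} (hF : F ⊆ M.E) (k r : ℕ) : (S1.rkSets (M ↾ F) k r).ncard ≤ (S1.rkSets M k r).ncard :=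
  ncard_le_ncard (fSets_subset_rkSets hF k r) (S1.rkSets_finite k r)

/-- A zero class of `M` is a zero class of `F`. -/
theorem ncard_fSets_eq_zero {F : Set α} (hF : F ⊆ M.E) (k r : ℕ) (h : (S1.rkSets M k r).ncard = 0) :
    (S1.rkSets (M ↾ F) k r).ncard = 0 :=
  Nat.le_zero.1 ((ncard_fSets_le hF k r).trans (le_of_eq h))

/-- **The partition row of `F`, upper bound**: `Σ_{r ∈ R} #fSets F k r ≤ C(|F|, k)`. -/
theorem sum_ncard_fSets_le_choose {F : Set α} (hF : F ⊆ M.E) (k : ℕ) (R : Finset ℕ) :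
    ∑ r ∈ R, (S1.rkSets (M ↾ F) k r).ncard ≤ F.ncard.choose k := by
  have hFfin : F.Finite := M.ground_finite.subset hF
  have hsub : (⋃ r ∈ (R : Set ℕ), S1.rkSets (M ↾ F) k r) ⊆ {A : Set α | A ⊆ F ∧ A.ncard = k} := by
    intro A hA
    rw [mem_iUnion₂] at hA
    obtain ⟨r, -, hAr⟩ := hA
    exact ⟨hAr.1, hAr.2.1⟩
  have hdisj : (R : Set ℕ).PairwiseDisjoint (fun r => S1.rkSets (M ↾ F) k r) := by
    intro r _ r' _ hrr'
    rw [Function.onFun, Set.disjoint_left]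
    rintro A ⟨-, -, hAr⟩ ⟨-, -, hAr'⟩
    apply hrr'
    have h := hAr.symm.trans hAr'
    exact_mod_cast h
  have heq := R.finite_toSet.ncard_biUnion (s := fun r => S1.rkSets (M ↾ F) k r) (fun r _ => fSets_finite hF k r) hdisj
  rw [finsum_mem_coe_finset] at heq
  rw [← heq, ← S1.ncard_setOf_subset_ncard_eq hFfin k]
  exact ncard_le_ncard hsub (hFfin.finite_subsets.subset (fun _ h => h.1))

/-- **The partition row of `F`, lower bound**: `C(|F|, k) ≤ Σ_{2 ≤ r ≤ q} #fSets F k r` for `k ≥ 2`, `ρ(F) = q`. -/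
theorem choose_le_sum_ncard_fSets (hpairs : ∀ e ∈ M.E, ∀ f ∈ M.E, e ≠ f → M.eRk {e, f} = 2)
    {F : Set α} (hF : F ⊆ M.E) {q : ℕ} (hFr : M.eRk F = (q : ℕ∞)) {k : ℕ} (hk : 2 ≤ k) :
    F.ncard.choose k ≤ ∑ r ∈ Finset.Icc 2 q, (S1.rkSets (M ↾ F) k r).ncard := by
  have hFfin : F.Finite := M.ground_finite.subset hF
  have hsub : {A : Set α | A ⊆ F ∧ A.ncard = k} ⊆ ⋃ r ∈ Finset.Icc 2 q, S1.rkSets (M ↾ F) k r := by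
    rintro A ⟨hAF, hAk⟩
    have hle : M.eRk A ≤ (q : ℕ∞) := by rw [← hFr]; exact M.eRk_mono hAF
    have hfin : M.eRk A ≠ ⊤ := ne_top_of_le_ne_top (ENat.coe_ne_top _) hle
    obtain ⟨a, ha⟩ := ENat.ne_top_iff_exists.mp hfin
    have h2 := S1.two_le_eRk_of_two_le_ncard hpairs (hAF.trans hF) (by omega)
    rw [← ha] at hle h2
    rw [mem_iUnion₂]
    exact ⟨a, Finset.mem_Icc.mpr ⟨by exact_mod_cast h2, by exact_mod_cast hle⟩, mem_rkSets_restrict.2 ⟨hAF, hAk, ha.symm⟩⟩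
  rw [← S1.ncard_setOf_subset_ncard_eq hFfin k]
  exact (ncard_le_ncard hsub ((Finset.Icc 2 q).finite_toSet.biUnion (fun r _ => fSets_finite hF k r))).trans
    (Finset.set_ncard_biUnion_le _ _)

/-- In a coloop-free matroid, deleting one point keeps the rank. -/
theorem eRk_ground_sdiff_singleton (hcol : M.coloops = ∅) {y : α} (hy : y ∈ M.E) :
    M.eRk (M.E \ {y}) = M.eRank := by
  by_contra hne
  have hcolx : M.IsColoop y := by
    rw [Matroid.isColoop_iff_notMem_closure_compl hy, S1.mem_closure_iff_eRk_insert_eq M hy sdiff_subset,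
      insert_sdiff_self_of_mem hy, M.eRk_ground]
    exact fun h => hne h.symm
  have hmem : y ∈ M.coloops := hcolx
  rw [hcol] at hmem
  exact hmem

/-- `|E ∖ F| = p − q + 1`. -/
theorem ncard_compl_eq {p q : ℕ} {F : Set α} (hF : F ⊆ M.E) (hFn : F.ncard + (p - q + 1) = M.E.ncard) :
    (M.E \ F).ncard = p - q + 1 := by
  have h := ncard_sdiff_add_ncard_of_subset hF M.ground_finite
  omega

section MaxFlat

variable {p q : ℕ} (hM : M.eRank = (p : ℕ∞)) (hcol : M.coloops = ∅) {F : Set α} (hF : F ⊆ M.E)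
  (hFr : M.eRk F = (q : ℕ∞)) (hqp : q < p) (hFn : F.ncard + (p - q + 1) = M.E.ncard)
include hM hcol hF hFr hqp hFn

/-- **THE RANK OF `F ∪ T`**: `ρ(F ∪ T) = q + |T|` for every proper subset `T` of `X = E ∖ F`. -/
theorem eRk_union_T {T : Set α} (hT : T ⊆ M.E \ F) (hTne : T ≠ M.E \ F) :
    M.eRk (F ∪ T) = ((q + T.ncard : ℕ) : ℕ∞) := by
  have hXfin : (M.E \ F).Finite := M.ground_finite.subset sdiff_subset
  have hTfin : T.Finite := hXfin.subset hT
  have hup : M.eRk (F ∪ T) ≤ ((q + T.ncard : ℕ) : ℕ∞) := by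
    have h := M.eRk_union_le_eRk_add_encard F T
    rw [hFr, ← hTfin.cast_ncard_eq] at h
    exact h.trans (le_of_eq (by push_cast; rfl))
  have hfin : M.eRk (F ∪ T) ≠ ⊤ := ne_top_of_le_ne_top (ENat.coe_ne_top _) hup
  obtain ⟨a, ha⟩ := ENat.ne_top_iff_exists.mp hfin
  obtain ⟨y, hyX, hyT⟩ := exists_of_ssubset (hT.ssubset_of_ne hTne)
  set D := ((M.E \ F) \ T) \ {y} with hD
  have hDfin : D.Finite := hXfin.subset (sdiff_subset.trans sdiff_subset)
  have hDn : D.ncard + T.ncard + 1 = p - q + 1 := by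
    have h1 := ncard_sdiff_add_ncard_of_subset hT hXfin
    have h2 : ((M.E \ F) \ T).ncard = D.ncard + 1 := by
      have hyD : y ∈ (M.E \ F) \ T := ⟨hyX, hyT⟩
      rw [hD, ncard_sdiff_singleton_of_mem hyD]
      have hne : ((M.E \ F) \ T).Nonempty := ⟨y, hyX, hyT⟩
      have : 0 < ((M.E \ F) \ T).ncard := (ncard_pos (hXfin.subset sdiff_subset)).2 hne
      omega
    rw [ncard_compl_eq hF hFn] at h1
    omega
  have hEy : M.E \ {y} = (F ∪ T) ∪ D := by
    ext z
    simp only [Set.mem_sdiff, Set.mem_singleton_iff, Set.mem_union, hD]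
    constructor
    · rintro ⟨hzE, hzy⟩
      by_cases hzF : z ∈ F
      · exact Or.inl (Or.inl hzF)
      by_cases hzT : z ∈ T
      · exact Or.inl (Or.inr hzT)
      exact Or.inr ⟨⟨⟨hzE, hzF⟩, hzT⟩, hzy⟩
    · rintro ((hzF | hzT) | ⟨⟨⟨hzE, -⟩, -⟩, hzy⟩)
      · exact ⟨hF hzF, fun h => hyX.2 (h ▸ hzF)⟩
      · exact ⟨(hT hzT).1, fun h => hyT (h ▸ hzT)⟩
      · exact ⟨hzE, hzy⟩
  have hrk : M.eRk (M.E \ {y}) = (p : ℕ∞) := by rw [eRk_ground_sdiff_singleton hcol hyX.1, hM]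
  have hlow : M.eRk (M.E \ {y}) ≤ M.eRk (F ∪ T) + D.encard := by
    rw [hEy]; exact M.eRk_union_le_eRk_add_encard _ _
  rw [hrk, ← ha, ← hDfin.cast_ncard_eq] at hlow
  have hlow' : p ≤ a + D.ncard := by exact_mod_cast hlow
  rw [← ha] at hup ⊢
  have hup' : a ≤ q + T.ncard := by exact_mod_cast hup
  congr 1
  omega

/-- **RANK ADDITIVITY OVER `F`**: `ρ(S ∪ T) = ρ(S) + |T|` for `S ⊆ F` and a proper subset `T` of `X = E ∖ F`. -/
theorem eRk_union_eq_add {S T : Set α} (hS : S ⊆ F) (hT : T ⊆ M.E \ F) (hTne : T ≠ M.E \ F) {r : ℕ}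
    (hSr : M.eRk S = (r : ℕ∞)) : M.eRk (S ∪ T) = ((r + T.ncard : ℕ) : ℕ∞) := by
  have hXfin : (M.E \ F).Finite := M.ground_finite.subset sdiff_subset
  have hTfin : T.Finite := hXfin.subset hT
  have hup : M.eRk (S ∪ T) ≤ ((r + T.ncard : ℕ) : ℕ∞) := by
    have h := M.eRk_union_le_eRk_add_encard S T
    rw [hSr, ← hTfin.cast_ncard_eq] at h
    exact h.trans (le_of_eq (by push_cast; rfl))
  have hfin : M.eRk (S ∪ T) ≠ ⊤ := ne_top_of_le_ne_top (ENat.coe_ne_top _) hup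
  obtain ⟨a, ha⟩ := ENat.ne_top_iff_exists.mp hfin
  have hsub := M.eRk_inter_add_eRk_union_le (S ∪ T) F
  have hinter : (S ∪ T) ∩ F = S := by
    ext z
    simp only [Set.mem_inter_iff, Set.mem_union]
    constructor
    · rintro ⟨hz | hz, hzF⟩
      · exact hz
      · exact absurd hzF (hT hz).2
    · intro hz; exact ⟨Or.inl hz, hS hz⟩
  have hunion : (S ∪ T) ∪ F = F ∪ T := by
    ext z; simp only [Set.mem_union]; constructor
    · rintro ((h | h) | h)
      · exact Or.inl (hS h)
      · exact Or.inr h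
      · exact Or.inl h
    · rintro (h | h)
      · exact Or.inr h
      · exact Or.inl (Or.inr h)
  rw [hinter, hunion, hSr, hFr, eRk_union_T hM hcol hF hFr hqp hFn hT hTne, ← ha] at hsub
  have hsub' : r + (q + T.ncard) ≤ a + q := by exact_mod_cast hsub
  rw [← ha] at hup ⊢
  have hup' : a ≤ r + T.ncard := by exact_mod_cast hup
  congr 1
  omega

end MaxFlat

section FlatH

variable (hpairs : ∀ e ∈ M.E, ∀ f ∈ M.E, e ≠ f → M.eRk {e, f} = 2)
  (hlines : ∀ L ⊆ M.E, M.eRk L = 2 → L.ncard ≤ 3) (hplanes : ∀ P ⊆ M.E, M.eRk P ≤ 3 → P.ncard ≤ 6)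
  (htens : ∀ X ⊆ M.E, M.eRk X ≤ 4 → X.ncard ≤ 10) (hnineteen : ∀ X ⊆ M.E, M.eRk X ≤ 5 → X.ncard ≤ 19)
  (hE2 : 2 ≤ M.E.ncard)
include hpairs hlines hplanes htens hnineteen hE2

/-- **THE UNSPLIT CLOSURE INSTANCE WITH AN ARBITRARY FLAT BOUND**: if the sets of rank `≤ b` have `≤ Fl` points, then for `b ≤ k`
`(k − b + 1 + rminL (k − b + 1))·m[k+1,b] ≤ (Fl − k)·m[k,b]`. -/
theorem cl_inst_flatH {b Fl : ℕ} (hflat : ∀ X ⊆ M.E, M.eRk X ≤ (b : ℕ∞) → X.ncard ≤ Fl) (k : ℕ) (hbk : b ≤ k) :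
    (k - b + 1 + rminL (k - b + 1)) * (S1.rkSets M (k + 1) b).ncard ≤ (Fl - k) * (S1.rkSets M k b).ncard := by
  refine S1.closure_incidence k b _ _ ?_ ?_
  · intro S hS hSk hSb
    exact lower_fibre hpairs hlines hplanes htens hnineteen hE2 k b hbk hS hSk hSb
  · intro A hAE hAk hAb
    have := S1.ncard_extensions_add_le_of_flat hflat hAE hAb
    omega

end FlatH

end S3MF

end PercRepro
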